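import Literature.Probability.Percolation.MarkedLoopLawSlide
import HarnessLib

/-!
# Attaching one UNMARKED hexagon: the all-or-nothing walk and the count split of the boundary law («LAW-ATTACH-SPLIT», F2 part 1)

Topic `Literature/Probability/Percolation`; generic-`k` layer of the marked-loop (Khristoforov–Smirnov) lineage; a rider on `MarkedLoopLawSlide.lean` («LAW-SLIDE», #848: the ring of
an attached hexagon `h` — `nbond`, `side_N_idx*`, `odd_xiDeg_iff_not_iff`, `eq_N_or_of_inc`, `exists_eq_N_of_mem` — and the SLIDE identity). The contraction identity F2 of HOME
`FINDING-BSPAN-SLIDE-INDUCTION.md` §2 compares `D' = (Ω ∪ h; M̂)` (the hexagon attached, NO mark on it) with `D = (Ω; M̂)` and `D₊ = (Ω; M̂ + P + Q)`: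
`law(Ω∪h; M̂) = law(Ω; M̂) + contract_{P,Q} law(Ω; M̂+P+Q)`. This file proves its first half, the part that involves only `D'` and `D` (same number of marks):

* `AttachData D' D h r m` — `D'.verts = insert h D.verts`, the outer run of `h` at ring offsets `k ≤ m` from `r` (`m ≤ 4`), and ALL corner faces common (`yc D' i = yc D i`); its ring
  facts (private copies of #848's ring plumbing — `h_mem`, `mem_hBonds'_iff`, `nb_not_mem_hBonds`, `outer_not_mem_hBonds'`, `N_not_touching`, `N_touching(')` —, whose
  statements print like the `SlideData` ones; public: `mem_touching'_iff`, `corners_eq`, `N_not_corner'`);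
* ★ `nbond_mem_iff_of_mem_TXb` — **THE ALL-OR-NOTHING WALK**: in a configuration of `D'` (odd face touching `G`) the new bonds `nb k`, `k ≤ m`, are ALL present or ALL absent
  (no corner on the outer path: no flip);
* ★★ `mem_TXb'_iff_of_subset` — for `ξ ⊆ H_G`: `ξ ∈ W^{D'}_z(s) ↔ ξ ∈ W^{D}_z(s)`; `inClassX'_iff_of_subset`, `linkRel'_eq` — same partner, same link relation (the configurations of
  `D'` avoiding the new bonds ARE the configurations of `D`, pattern for pattern);
* ★★★ `AttachData.card_filter_eq_add` / `AttachData.patternCount_eq_add_present` — **THE COUNT SPLIT**: for every pattern `p` and every `H_G`-edge `z`,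
  `N_p^{D'}(z) = N_p^{D}(z) + N_p^{D', present}(z)`, where `presentCount` counts the configurations of `D'` containing the first new bond (hence the whole outer path).

F2 part 2 (the heir's «LAW-CONTRACT»): `N_p^{D', present}` is the sum of `N_{p₊}^{D₊}` over the patterns `p₊` of `D₊` contracting to `p` (the strands through `P` and `Q` are
concatenated along the outer path), i.e. `lawLP z' = lawLP z + contractL j (lawLP z₊)` in the planar Temperley–Lieb module.

## References
* M. Khristoforov, S. Smirnov, *Percolation and O(1) loop model*, arXiv:2111.15612 (2021), §1.2 (arXiv v1 pp. 2–3: loop configurations with disorders, the link pattern),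
  §2 Definition 3 (p. 4), Remark 6 (p. 5).
* B. Bollobás, O. Riordan, *Percolation*, CUP (2006), Ch. 7 §7.2.2 pp. 168–169.
* P. A. Pearce, V. Rittenberg, J. de Gier, B. Nienhuis, *Temperley–Lieb stochastic processes*, J. Phys. A 35 (2002) L661–L668, §2 (the monoid: contraction).

## Mathlib / tree
Tree: `MarkedLoopLawSlide` (`nbond`, `nbond_inj`, `side_N_idx`, `side_N_idx_add_one`, `side_N_idx_add_two`, `odd_xiDeg_iff_not_iff`, `eq_N_or_of_inc`, `exists_eq_N_of_mem`, `N_inj`),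
`KhSThreeDisorderObservable` (`TXb`, `mem_TXb_iff`, `ParityIs`, `InClassX`, `hbK_inClassX_iff`), `MarkedLoopSpace` (`hBonds`, `mem_hBonds`, `exists_rep_of_mem_hBonds`,
`mem_touching_of_side_mem`, `corners`, `mem_corners`, `yc`, `yc_mem_touching`, `not_corner_of_two_mem`), `MarkedLoopHolomorphy` (`linkRel`, `mem_linkRel`), `MarkedLoopTripodBasis`
(`Pat`, `patternCount`), `TriDiscShelling` (`leftFaceDir`, `RemovableAt.hexFaceVertices_leftFaceDir`, `mem_triFacesTouching`, `triGraph_adj_iff_triDir`, `add_triDir_ne`).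
Mathlib: `Finset.card_filter_add_card_filter_not`, `Finset.filter_filter`, `Finset.filter_congr`.
-/

open Finset

namespace Literature.Probability.Percolation.MarkedLoops

open Literature.Probability.Percolation Literature.Probability.LatticeModels
open Literature.Probability.Percolation.FivePoint (side side_injective XiLinked Inc inc_side inc_mk_iff xiDeg)
open Literature.Probability.Percolation.FivePoint.N5 (sideGraph side_oppFace_oppIdx xiLinked_iff_reachable l1_xiDeg_eq)
open TriMarkedDomain

section Attach

variable {nm : ℕ}

/-- **ONE UNMARKED HEXAGON ATTACHED.** Two `k`-marked discrete domains `D` on `G` and `D'` on `G ∪ {h}`, `h ∉ G`, the neighbours of `h` at ring offsets `k ≤ m` from `r` outside `G` and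
those at offsets `k > m` inside (`m ≤ 4`), with ALL corner faces in common (no mark on the attached hexagon, none moved): `D = (Ω; M̂)`, `D' = (Ω ∪ h; M̂)`.
[cite: KhristoforovSmirnov2021, §1.2 (arXiv v1 p. 2); BollobasRiordan2006, Ch. 7 §7.2.2 pp. 168–169] -/
structure AttachData (D' D : TriMarkedDomain nm) (h : Site 2) (r m : Fin 6) : Prop where
  /-- the big domain is the small one plus the hexagon `h` -/
  verts' : D'.verts = insert h D.verts
  /-- `h` is a new site -/
  not_mem : h ∉ D.verts
  /-- the outer run of `h` -/
  out : ∀ k : Fin 6, k ≤ m → h + triDir (r + k) ∉ D.verts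
  /-- the contact arc -/
  inside : ∀ k : Fin 6, m < k → h + triDir (r + k) ∈ D.verts
  /-- at least one contact cell -/
  m_le : m.val ≤ 4
  /-- all corner faces are common -/
  yc_eq : ∀ i, yc D' i = yc D i

namespace AttachData

variable {D' D : TriMarkedDomain nm} {h : Site 2} {r m : Fin 6} (T : AttachData D' D h r m)
include T

omit T in
/-- `Fin 6` bookkeeping of the outer run. [cite: BollobasRiordan2006, Ch. 7 §7.2.2 p. 168; lane plumbing] -/
private theorem fin_run (k m : Fin 6) (hm : m.val ≤ 4) : (k < m → k + 1 ≤ m) ∧ m < 5 ∧ (m ≤ k → k ≠ 5 → m < k + 1) ∧ (1 ≤ k.val → (k + 5).val = k.val - 1 ∧ k + 5 + 1 = k) := by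
  revert hm; revert k m; decide

/-! ### Sites, bonds, faces -/

/-- `h` is a site of `D'`. [cite: BollobasRiordan2006, Ch. 7 §7.2.2 p. 168] -/
private theorem h_mem : h ∈ D'.verts := by rw [T.verts']; exact Finset.mem_insert_self _ _

/-- `G ⊆ G'`. [cite: BollobasRiordan2006, Ch. 7 §7.2.2 p. 168] -/
private theorem verts_subset : D.verts ⊆ D'.verts := by rw [T.verts']; exact Finset.subset_insert _ _

/-- `H_G ⊆ H_{G'}`. [cite: KhristoforovSmirnov2021, §1.2 (arXiv v1 p. 2)] -/
private theorem hBonds_subset : hBonds D ⊆ hBonds D' := by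
  intro b hb
  obtain ⟨u, w, rfl, hu, hadj⟩ := exists_rep_of_mem_hBonds D hb
  exact mem_hBonds D' hadj (Or.inl (T.verts_subset hu))

/-- ★ **`H_{G'} = H_G ⊔ {nb k : k ≤ m}`.** [cite: KhristoforovSmirnov2021, §1.2 (arXiv v1 p. 2: the edges of `H_Ω`)] -/
private theorem mem_hBonds'_iff {b : Sym2 (Site 2)} : b ∈ hBonds D' ↔ b ∈ hBonds D ∨ ∃ k : Fin 6, k ≤ m ∧ b = nbond h (r + k) := by
  constructor
  · intro hb
    obtain ⟨u, w, rfl, hu, hadj⟩ := exists_rep_of_mem_hBonds D' hb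
    rw [T.verts', Finset.mem_insert] at hu
    rcases hu with rfl | hu
    · obtain ⟨j, rfl⟩ := (triGraph_adj_iff_triDir u w).1 hadj
      obtain ⟨k, rfl⟩ : ∃ k : Fin 6, j = r + k := ⟨j - r, by rw [add_sub_cancel]⟩
      by_cases hk : k ≤ m
      · exact Or.inr ⟨k, hk, rfl⟩
      · refine Or.inl ?_
        have hb₁ := mem_hBonds D hadj.symm (Or.inl (T.inside k (not_le.1 hk)))
        rwa [Sym2.eq_swap] at hb₁
    · exact Or.inl (mem_hBonds D hadj (Or.inl hu))
  · rintro (hb | ⟨k, -, rfl⟩)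
    · exact T.hBonds_subset hb
    · exact mem_hBonds D' (triGraph_adj_add_triDir h _) (Or.inl T.h_mem)

/-- the new bonds are not bonds of `H_G`. [cite: KhristoforovSmirnov2021, §1.2 (arXiv v1 p. 2)] -/
private theorem nb_not_mem_hBonds {k : Fin 6} (hk : k ≤ m) : nbond h (r + k) ∉ hBonds D := by
  intro hb
  obtain ⟨u, w, he, hu, -⟩ := exists_rep_of_mem_hBonds D hb
  have hu' : u ∈ (nbond h (r + k) : Sym2 (Site 2)) := by rw [he]; exact Sym2.mem_mk_left u w
  rcases Sym2.mem_iff.1 hu' with rfl | rfl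
  · exact T.not_mem hu
  · exact T.out k hk hu

/-- the outer side of `N_k`, `k < m`, is not a bond of `H_{G'}`. [cite: KhristoforovSmirnov2021, §1.2 (arXiv v1 p. 2)] -/
private theorem outer_not_mem_hBonds' {k : Fin 6} (hk : k < m) : s(h + triDir (r + k), h + triDir (r + k + 1)) ∉ hBonds D' := by
  intro hb
  obtain ⟨u, w, he, hu, -⟩ := exists_rep_of_mem_hBonds D' hb
  rw [T.verts', Finset.mem_insert] at hu
  have hu' : u ∈ (s(h + triDir (r + k), h + triDir (r + k + 1)) : Sym2 (Site 2)) := by rw [he]; exact Sym2.mem_mk_left u w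
  have hk1 := (fin_run k m T.m_le).1 hk
  rcases Sym2.mem_iff.1 hu' with rfl | rfl
  · rcases hu with e | hu
    · exact add_triDir_ne h _ e
    · exact T.out k hk.le hu
  · rcases hu with e | hu
    · exact add_triDir_ne h _ e
    · rw [add_assoc] at hu
      exact T.out (k + 1) hk1 hu

/-- ★ the outer-path faces `N_k`, `k < m`, do not touch `G`. [cite: BollobasRiordan2006, Ch. 7 §7.2.2 p. 168] -/
private theorem N_not_touching {k : Fin 6} (hk : k < m) : leftFaceDir h (r + k) ∉ triFacesTouching D.verts := by
  intro ht
  obtain ⟨u, hu, huF⟩ := mem_triFacesTouching.1 ht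
  rw [RemovableAt.hexFaceVertices_leftFaceDir, Finset.mem_insert, Finset.mem_insert, Finset.mem_singleton] at huF
  have hk1 := (fin_run k m T.m_le).1 hk
  rcases huF with rfl | rfl | rfl
  · exact T.not_mem hu
  · exact T.out k hk.le hu
  · rw [add_assoc] at hu
    exact T.out (k + 1) hk1 hu

/-- every face `N_{r+k}` touches `G'`. [cite: BollobasRiordan2006, Ch. 7 §7.2.2 p. 168] -/
private theorem N_touching' (k : Fin 6) : leftFaceDir h (r + k) ∈ triFacesTouching D'.verts :=
  mem_triFacesTouching.2 ⟨h, T.h_mem, by rw [RemovableAt.hexFaceVertices_leftFaceDir]; exact Finset.mem_insert_self _ _⟩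

/-- the faces `N_k`, `m ≤ k`, touch `G`. [cite: BollobasRiordan2006, Ch. 7 §7.2.2 p. 168] -/
private theorem N_touching {k : Fin 6} (hk : m ≤ k) : leftFaceDir h (r + k) ∈ triFacesTouching D.verts := by
  have F := fin_run k m T.m_le
  rw [mem_triFacesTouching]
  by_cases e : k = 5
  · subst e
    exact ⟨h + triDir (r + 5), T.inside 5 F.2.1, by rw [RemovableAt.hexFaceVertices_leftFaceDir]; simp⟩
  · refine ⟨h + triDir (r + (k + 1)), T.inside (k + 1) (F.2.2.1 hk e), ?_⟩
    rw [RemovableAt.hexFaceVertices_leftFaceDir, ← add_assoc]; simp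

/-- ★ **the faces touching `G'`** are those touching `G` and the outer-path faces. [cite: BollobasRiordan2006, Ch. 7 §7.2.2 p. 168] -/
theorem mem_touching'_iff {F : HexVertex} : F ∈ triFacesTouching D'.verts ↔ F ∈ triFacesTouching D.verts ∨ ∃ k : Fin 6, k < m ∧ F = leftFaceDir h (r + k) := by
  constructor
  · intro hF
    obtain ⟨u, hu, huF⟩ := mem_triFacesTouching.1 hF
    rw [T.verts', Finset.mem_insert] at hu
    rcases hu with rfl | hu
    · obtain ⟨k, rfl⟩ := exists_eq_N_of_mem r huF
      by_cases hk : k < m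
      · exact Or.inr ⟨k, hk, rfl⟩
      · exact Or.inl (T.N_touching (not_lt.1 hk))
    · exact Or.inl (mem_triFacesTouching.2 ⟨u, hu, huF⟩)
  · rintro (hF | ⟨k, -, rfl⟩)
    · obtain ⟨u, hu, huF⟩ := mem_triFacesTouching.1 hF
      exact mem_triFacesTouching.2 ⟨u, T.verts_subset hu, huF⟩
    · exact T.N_touching' k

/-- the corner faces are the same set, and they touch `G`. [cite: BollobasRiordan2006, Ch. 7 §7.2.2 p. 169] -/
theorem corners_eq : corners D' = corners D := by
  ext F
  rw [mem_corners, mem_corners]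
  exact ⟨fun ⟨i, e⟩ => ⟨i, e.trans (T.yc_eq i)⟩, fun ⟨i, e⟩ => ⟨i, e.trans (T.yc_eq i).symm⟩⟩

/-- the outer-path faces are not corner faces. [cite: BollobasRiordan2006, Ch. 7 §7.2.2 p. 169] -/
theorem N_not_corner' {k : Fin 6} (hk : k < m) : leftFaceDir h (r + k) ∉ corners D' := by
  rw [T.corners_eq, mem_corners]
  rintro ⟨i, e⟩
  exact T.N_not_touching hk (e ▸ yc_mem_touching D i)

/-! ### The all-or-nothing walk -/

/-- ★ **THE ALL-OR-NOTHING WALK**: in a configuration of `D'` at an `H_G`-edge (odd face touching `G`) the new bonds `nb k`, `k ≤ m`, are all present or all absent — the outer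
path carries no corner, so the parity walk never flips. [cite: KhristoforovSmirnov2021, §1.2 (arXiv v1 pp. 2–3: prescribed disorders)] -/
theorem nbond_mem_iff_of_mem_TXb {v : HexVertex} {i : Fin 3} {s : HexVertex} (hs : s ∈ triFacesTouching D.verts) {ζ : Finset (Sym2 (Site 2))}
    (hζ : ζ ∈ TXb D' v i s) {k : Fin 6} (hk : k ≤ m) : nbond h (r + k) ∈ ζ ↔ nbond h r ∈ ζ := by
  obtain ⟨hsub, hpar⟩ := (mem_TXb_iff (D := D') v i s ζ).1 hζ
  have hsub' : ζ ⊆ hBonds D' := fun b hb => (Finset.mem_erase.1 (hsub hb)).2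
  -- one step: no flip
  have step : ∀ k : Fin 6, k < m → (nbond h (r + (k + 1)) ∈ ζ ↔ nbond h (r + k) ∈ ζ) := by
    intro k hk'
    have hp := hpar (leftFaceDir h (r + k)) (T.N_touching' k)
    rw [odd_xiDeg_iff_not_iff (leftFaceIdx (r + k)) (fun hm => T.outer_not_mem_hBonds' hk' (by rw [← side_N_idx]; exact hsub' hm)), side_N_idx_add_one,
      side_N_idx_add_two, add_assoc, Finset.mem_symmDiff, Finset.mem_singleton] at hp
    have hks : leftFaceDir h (r + k) ≠ s := fun e => T.N_not_touching hk' (e ▸ hs)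
    have hkc : leftFaceDir h (r + k) ∉ corners D' := T.N_not_corner' hk'
    simp only [hks, hkc, not_false_iff, and_true, or_false, iff_false, not_not] at hp
    exact hp
  suffices H : ∀ n : ℕ, ∀ k : Fin 6, k.val = n → k ≤ m → (nbond h (r + k) ∈ ζ ↔ nbond h r ∈ ζ) from H k.val k rfl hk
  intro n
  induction n with
  | zero =>
    intro k hk0 _
    have e : k = 0 := Fin.ext hk0
    subst e
    rw [add_zero]
  | succ n ih =>
    intro k hkn hkm
    obtain ⟨hv, hs'⟩ := (fin_run k m T.m_le).2.2.2 (by omega)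
    have hlt : k + 5 < m := by rw [Fin.lt_def, hv]; rw [Fin.le_def] at hkm; omega
    have h1 := ih (k + 5) (by rw [hv]; omega) hlt.le
    have h2 := step (k + 5) hlt
    rw [hs'] at h2
    exact h2.trans h1

/-! ### Configurations avoiding the new bonds are the configurations of `D` -/

/-- ★★ **for `ξ ⊆ H_G`: `ξ ∈ W^{D'}_z(s) ↔ ξ ∈ W^{D}_z(s)`** (`z = side v i` an `H_G`-edge, `s` touching `G`): the outer-path faces see no side of `ξ`, every other face has the same side
count and the same corner status. [cite: KhristoforovSmirnov2021, §1.2 (arXiv v1 pp. 2–3); §2 Definition 3 (p. 4)] -/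
theorem mem_TXb'_iff_of_subset {ξ : Finset (Sym2 (Site 2))} (hξ : ξ ⊆ hBonds D) (v : HexVertex) (i : Fin 3) {s : HexVertex}
    (hs : s ∈ triFacesTouching D.verts) : ξ ∈ TXb D' v i s ↔ ξ ∈ TXb D v i s := by
  rw [mem_TXb_iff, mem_TXb_iff, T.corners_eq]
  refine and_congr ⟨fun h1 b hb => Finset.mem_erase.2 ⟨(Finset.mem_erase.1 (h1 hb)).1, hξ hb⟩,
    fun h1 b hb => Finset.mem_erase.2 ⟨(Finset.mem_erase.1 (h1 hb)).1, T.hBonds_subset (hξ hb)⟩⟩ ?_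
  unfold ParityIs
  constructor
  · intro hP F hF
    exact hP F (T.mem_touching'_iff.2 (Or.inl hF))
  · intro hP F hF
    rcases T.mem_touching'_iff.1 hF with hF₁ | ⟨k, hk, rfl⟩
    · exact hP F hF₁
    · have h0 : xiDeg ξ (leftFaceDir h (r + k)) = 0 := by
        rw [l1_xiDeg_eq, Finset.card_eq_zero, Finset.filter_eq_empty_iff]
        intro j _ hj
        exact T.N_not_touching hk (mem_touching_of_side_mem D (hξ hj))
      rw [h0, Finset.mem_symmDiff, Finset.mem_singleton, ← T.corners_eq]
      have hks : leftFaceDir h (r + k) ≠ s := fun e => T.N_not_touching hk (e ▸ hs)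
      have hkc : leftFaceDir h (r + k) ∉ corners D' := T.N_not_corner' hk
      simp only [hks, hkc, false_and, or_self, iff_false]
      exact fun h1 => absurd h1 (by decide)

/-- ★ **same partner.** [cite: KhristoforovSmirnov2021, §2 Definition 3 (arXiv v1 p. 4: the event `z ↔ u_j`)] -/
theorem inClassX'_iff_of_subset {ξ : Finset (Sym2 (Site 2))} (hξ : ξ ⊆ hBonds D) (v : HexVertex) (i : Fin 3) {s : HexVertex}
    (hs : s ∈ triFacesTouching D.verts) (j : Fin nm) :
    InClassX D' (faceVertex v (i + 1)) (faceVertex v (i + 2)) s j ξ ↔ InClassX D (faceVertex v (i + 1)) (faceVertex v (i + 2)) s j ξ := by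
  rw [hbK_inClassX_iff, hbK_inClassX_iff, T.yc_eq j]
  exact and_congr (T.mem_TXb'_iff_of_subset hξ v i hs) Iff.rfl

/-- ★ **same link relation.** [cite: KhristoforovSmirnov2021, §1.2 (arXiv v1 p. 2: the link pattern `IP(ξ)`)] -/
theorem linkRel'_eq (ξ : Finset (Sym2 (Site 2))) : linkRel D' ξ = linkRel D ξ := by
  ext ⟨c, d⟩
  rw [mem_linkRel, mem_linkRel, T.yc_eq c, T.yc_eq d]

/-- a configuration of `D'` avoiding the first new bond avoids them all and is supported on `H_G`. [cite: KhristoforovSmirnov2021, §1.2 (arXiv v1 p. 2)] -/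
theorem subset_hBonds_of_not_mem {v : HexVertex} {i : Fin 3} {s : HexVertex} (hs : s ∈ triFacesTouching D.verts) {ζ : Finset (Sym2 (Site 2))} (hζ : ζ ∈ TXb D' v i s)
    (h0 : nbond h r ∉ ζ) : ζ ⊆ hBonds D := by
  intro b hb
  have hb' : b ∈ hBonds D' := (Finset.mem_erase.1 (((mem_TXb_iff (D := D') v i s ζ).1 hζ).1 hb)).2
  rcases T.mem_hBonds'_iff.1 hb' with h1 | ⟨k, hk, rfl⟩
  · exact h1
  · exact absurd ((T.nbond_mem_iff_of_mem_TXb hs hζ hk).1 hb) h0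

/-! ### The count split -/

open Classical in
/-- ★★★ **THE COUNT SPLIT AT ONE HALF OF THE EDGE**: the configurations of `D'` with partner `u_j` and link relation `L` are those of `D` (no new bond) plus those containing the first
new bond (hence the whole outer path). [cite: KhristoforovSmirnov2021, §1.2 (arXiv v1 p. 2: the law of the link pattern); §2 Definition 3 (p. 4)] -/
theorem card_filter_eq_add (v : HexVertex) (i : Fin 3) {s : HexVertex} (hs : s ∈ triFacesTouching D.verts) (j : Fin nm) (L : Finset (Fin nm × Fin nm)) :
    #((TXb D' v i s).filter fun ζ => InClassX D' (faceVertex v (i + 1)) (faceVertex v (i + 2)) s j ζ ∧ linkRel D' ζ = L) =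
      #((TXb D v i s).filter fun ξ => InClassX D (faceVertex v (i + 1)) (faceVertex v (i + 2)) s j ξ ∧ linkRel D ξ = L) +
        #((TXb D' v i s).filter fun ζ => (InClassX D' (faceVertex v (i + 1)) (faceVertex v (i + 2)) s j ζ ∧ linkRel D' ζ = L) ∧ nbond h r ∈ ζ) := by
  rw [← Finset.card_filter_add_card_filter_not (fun ζ => nbond h r ∈ ζ), Finset.filter_filter, Finset.filter_filter, add_comm]
  congr 1
  congr 1
  ext ζ
  simp only [Finset.mem_filter]
  constructor
  · rintro ⟨hmem, ⟨hcl, hL⟩, hnot⟩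
    have hsub := T.subset_hBonds_of_not_mem hs hmem hnot
    exact ⟨(T.mem_TXb'_iff_of_subset hsub v i hs).1 hmem, (T.inClassX'_iff_of_subset hsub v i hs j).1 hcl, (T.linkRel'_eq ζ) ▸ hL⟩
  · rintro ⟨hmem, hcl, hL⟩
    have hsub : ζ ⊆ hBonds D := fun b hb => (Finset.mem_erase.1 (((mem_TXb_iff (D := D) v i s ζ).1 hmem).1 hb)).2
    refine ⟨(T.mem_TXb'_iff_of_subset hsub v i hs).2 hmem, ⟨(T.inClassX'_iff_of_subset hsub v i hs j).2 hcl, (T.linkRel'_eq ζ).symm ▸ hL⟩, fun hb => ?_⟩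
    exact T.nb_not_mem_hBonds (k := 0) (Fin.zero_le _) (by rw [add_zero]; exact hsub hb)

open Classical in
/-- **the present-part count `N_p^{D', present}(z)`**: configurations of `D'` (both halves of the edge) containing the first new bond, with pattern `p`.
[cite: KhristoforovSmirnov2021, §1.2 (arXiv v1 p. 2: the law of the link pattern); lane tool notion] -/
noncomputable def presentCount (D' : TriMarkedDomain nm) (h : Site 2) (r : Fin 6) (v : HexVertex) (i : Fin 3) (p : Pat nm) : ℕ :=
  #((TXb D' v i v).filter fun ζ => (InClassX D' (faceVertex v (i + 1)) (faceVertex v (i + 2)) v p.1.1 ζ ∧ linkRel D' ζ = p.1.2) ∧ nbond h r ∈ ζ) +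
    #((TXb D' v i (oppFace v i)).filter fun ζ => (InClassX D' (faceVertex v (i + 1)) (faceVertex v (i + 2)) (oppFace v i) p.1.1 ζ ∧ linkRel D' ζ = p.1.2) ∧ nbond h r ∈ ζ)

/-- ★★★ **THE COUNT SPLIT FOR THE PATTERN COUNTS**: `N_p^{D'}(z) = N_p^{D}(z) + N_p^{D', present}(z)` at every `H_G`-edge `z = side v i`, for every pattern `p` — the first half of
F2 (`law(Ω∪h; M̂) = law(Ω; M̂) + contract_{P,Q} law(Ω; M̂+P+Q)`; the present part is the contraction term, typed separately).
[cite: KhristoforovSmirnov2021, §1.2 (arXiv v1 p. 2: the law of the link pattern), §2 Definition 3 (p. 4); PearceRittenbergDeGierNienhuis2002, §2 (the monoid: contraction)] -/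
theorem patternCount_eq_add_present {v : HexVertex} {i : Fin 3} (hz : side v i ∈ hBonds D) (p : Pat nm) :
    patternCount D' v i p = patternCount D v i p + presentCount D' h r v i p := by
  have hv : v ∈ triFacesTouching D.verts := mem_touching_of_side_mem D hz
  have ho : oppFace v i ∈ triFacesTouching D.verts := mem_touching_of_side_mem D (j := oppIdx v i) (by rw [side_oppFace_oppIdx]; exact hz)
  unfold patternCount presentCount
  rw [T.card_filter_eq_add v i hv p.1.1 p.1.2, T.card_filter_eq_add v i ho p.1.1 p.1.2]
  ring

end AttachData

end Attach

end Literature.Probability.Percolation.MarkedLoops
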